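import Summits.PneNP.PneNP.Theses.SymmetryBudget
import Literature.Computability.Complexity.SymmetricCircuit
import Literature.Computability.Complexity.KarpProblems
import Literature.Combinatorics.SimpleGraph.HamiltonianCycleListings
import Literature.Computability.Complexity.FPStringBricks

/-!
# `WindowBarrier` (stmt-PneNP-2145) — negative-side support I: the invariance clause is load-bearing,
# and a refutation would be a generic bridge

(Companion file `Negative/BudgetZero.lean`: without the SYMMETRY requirement the crux is false.)

Route `PneNP/SymmetryBudget`, crux rank 4 (`Summit.PneNP.PneNP.Theses.SymmetryBudget.WindowBarrier`):
some `L ∈ P` with `Bud(m,⌊log₂ m⌋)`-invariant graph slices has, for every polynomial `p`, infinitely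
often no `Bud(m,⌊log₂ m⌋)`-symmetric threshold circuit of size `≤ p m` (inline `Sym`/`HasSym`/`Bud` =
`Circuit.IsSymmetricUnder` / `HasSymCircuit tcBasis` / `pointStabiliserBudget` of
`Literature.Computability.Complexity.SymmetricCircuit`, by `Iff.rfl`). Sorry-free facts recorded by the
crux disprover (cdisprove seat), none of which asserts a route item:

* `not_hasSymCircuit_of_not_invariant` — a function that is not `Γ`-invariant has no `Γ`-symmetric
  `tcBasis` circuit of any size (symmetry ⇒ invariance, Anderson–Dawar 2017 §2.2, from the tree lemma
  `Circuit.IsSymmetricUnder.invariant_of_computes`).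
* `hardness_without_invariance` — the HARDNESS clause of the crux alone is a triviality: the
  `P`-language `{w | probe w = [1]}` reading the single adjacency bit of the pair `(0, m-1)` has
  non-invariant slices at every `m ≥ 4`, hence NO `Bud(m,⌊log₂ m⌋)`-symmetric threshold circuits of any
  size there. So "WindowBarrier minus its invariance clause" is a theorem and the crux's content is the
  conjunction invariance ∧ hardness for one `L`.
* `ham_not_mem_P_of_not_windowBarrier` — `¬ WindowBarrier → WindowHam → HAMCIRCUIT ∉ P`: the slices
  of `HAMCIRCUIT` are invariant under all vertex permutations, so if HAM were in `P` the lower-bound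
  crux `WindowHam` would itself witness `WindowBarrier`. A refutation of the crux is therefore a
  generic bridge from the route's symmetric lower bound to `P ≠ NP` ("no hidden order at scale
  `log m`"), which is why no cheap refutation exists.
-/

namespace Summit.PneNP.WindowBarrier.Negative

open scoped Classical
open Filter Literature.Computability.Complexity Summit.PneNP.PneNP.Theses.SymmetryBudget
open _root_.Computability

/-! ### Symmetry implies invariance, contrapositive -/

/-- A function on `m × m` matrices that is NOT invariant under some `ρ ∈ Γ` (acting diagonally) has
no `Γ`-symmetric threshold circuit of any size (Anderson–Dawar 2017, §2.2 "symmetry implies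
invariance", tree lemma `Circuit.IsSymmetricUnder.invariant_of_computes`). [folklore] -/
theorem not_hasSymCircuit_of_not_invariant {m : ℕ} {Γ : Set (Equiv.Perm (Fin m))} {s : ℕ}
    {f : (Fin m × Fin m → Bool) → Bool}
    (h : ∃ ρ ∈ Γ, ∃ x, f (fun q : Fin m × Fin m => x (ρ q.1, ρ q.2)) ≠ f x) :
    ¬ HasSymCircuit tcBasis Γ s f := by
  rintro ⟨C, hB, -, hΓ, hf⟩
  obtain ⟨ρ, hρ, x, hx⟩ := h
  exact hx (hΓ.invariant_of_computes hB hf hρ x)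

/-! ### The hardness clause alone is cheap: a `P` language with non-invariant slices -/

/-! The probe `⟨a, b⟩ ↦ bitAt ⟨tail 1^{min(⟦a⟧,|b|)}, b⟩`, written out as the `FP`-brick composite
`bitAtFn ∘ fanoutFn (List.tail ∘ binToUnaryFn ∘ fanoutFn sndP fstP) sndP` (no abbreviation is
introduced, to keep this file notation- and definition-free): on a graph code `⟨encodeNat m, bits⟩`
(`m ≥ 1`) it returns `[bits[m-1]]`, the adjacency bit of the pair `(0, m-1)`. -/

/-- `probe ∈ FP` (composition of tree bricks). [folklore] -/
theorem probe_mem_FP :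
    (bitAtFn ∘ fanoutFn (List.tail ∘ binToUnaryFn ∘ fanoutFn sndP fstP) sndP) ∈ FP :=
  comp_mem_FP bitAtFn_mem_FP
    (fanoutFn_mem_FP (comp_mem_FP PRelSigma.tail_mem_FP
      (comp_mem_FP binToUnaryFn_mem_FP (fanoutFn_mem_FP sndP_mem_FP fstP_mem_FP))) sndP_mem_FP)

/-- The probe language `{w | probe w = [1]}` is in `P` (equality test of two `FP` maps). [folklore] -/
theorem probeLang_mem_P :
    ({w | (bitAtFn ∘ fanoutFn (List.tail ∘ binToUnaryFn ∘ fanoutFn sndP fstP) sndP) w = [true]} :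
      Language Bool) ∈ Classes.P :=
  setOf_apply_eq_apply_mem_P probe_mem_FP (const_mem_FP [true])

/-- The probe on a pair. [folklore] -/
theorem probe_boolPair (a b : List Bool) :
    (bitAtFn ∘ fanoutFn (List.tail ∘ binToUnaryFn ∘ fanoutFn sndP fstP) sndP) (boolPair a b) =
      bitAtFn (boolPair (ones (min (bitsToNat a) b.length - 1)) b) := by
  simp only [Function.comp_apply, fanoutFn_apply, sndP_boolPair, fstP_boolPair,
    binToUnaryFn_boolPair]
  congr 2
  simp [ones, List.tail_replicate]

/-- Row-major position `m - 1` is the pair `(0, m-1)`. [folklore] -/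
theorem finProdFinEquiv_symm_pred {m : ℕ} (hm : 1 ≤ m) :
    finProdFinEquiv.symm (⟨m - 1, by nlinarith [Nat.sub_lt hm Nat.one_pos]⟩ : Fin (m * m)) =
      ((⟨0, hm⟩ : Fin m), (⟨m - 1, Nat.sub_lt hm Nat.one_pos⟩ : Fin m)) := by
  rw [Equiv.symm_apply_eq]
  ext
  simp

/-- On a graph code with `m ≥ 1` vertices the probe returns the adjacency bit of `(0, m-1)`.
[folklore] -/
theorem probe_encode {m : ℕ} (hm : 1 ≤ m) (G : SimpleGraph (Fin m)) :
    (bitAtFn ∘ fanoutFn (List.tail ∘ binToUnaryFn ∘ fanoutFn sndP fstP) sndP) (encodingGraph.encode ⟨m, G⟩) =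
      [decide (G.Adj ⟨0, hm⟩ ⟨m - 1, Nat.sub_lt hm Nat.one_pos⟩)] := by
  rw [encodingGraph_encode, probe_boolPair]
  have hlen : ((encodingGraphFin m).encode G).length = m * m := by
    simp [encodingGraphFin, encodingBitVec]
  have hmin : min (bitsToNat (encodeNat m)) ((encodingGraphFin m).encode G).length - 1 = m - 1 := by
    rw [bitsToNat_encodeNat, hlen, Nat.min_eq_left (Nat.le_mul_self m)]
  rw [hmin, bitAtFn_boolPair_of_lt _ _ (by simp [ones, hlen]; nlinarith [Nat.sub_lt hm Nat.one_pos])]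
  simp only [ones, List.length_replicate, List.cons.injEq, and_true]
  show (List.ofFn fun k : Fin (m * m) =>
      decide (G.Adj (finProdFinEquiv.symm k).1 (finProdFinEquiv.symm k).2))[m - 1]'(by
        simp; nlinarith [Nat.sub_lt hm Nat.one_pos]) = _
  rw [List.getElem_ofFn, finProdFinEquiv_symm_pred hm]

/-- Hence membership of a graph code (`m ≥ 1`) in the probe language is the single adjacency test
`0 ~ m-1`. [folklore] -/
theorem encode_mem_probeLang_iff {m : ℕ} (hm : 1 ≤ m) (G : SimpleGraph (Fin m)) :
    encodingGraph.encode ⟨m, G⟩ ∈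
        ({w | (bitAtFn ∘ fanoutFn (List.tail ∘ binToUnaryFn ∘ fanoutFn sndP fstP) sndP) w = [true]} :
          Language Bool) ↔
      G.Adj ⟨0, hm⟩ ⟨m - 1, Nat.sub_lt hm Nat.one_pos⟩ := by
  change (bitAtFn ∘ fanoutFn (List.tail ∘ binToUnaryFn ∘ fanoutFn sndP fstP) sndP)
      (encodingGraph.encode ⟨m, G⟩) = [true] ↔ _
  rw [probe_encode hm]
  simp

/-- For `m ≥ 4` the graph slice of the probe language is NOT invariant under the budget
`Bud(m, ⌊log₂ m⌋)` (`⌊log₂ m⌋ ≥ 2`, so the vertices `m-1`, `m-2` are free): swapping them moves the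
probed pair; witness matrix = the single entry `(0, m-2)`. [folklore] -/
theorem probe_slice_not_invariant {m : ℕ} (hm : 4 ≤ m) :
    ∃ ρ ∈ pointStabiliserBudget m (Nat.log 2 m), ∃ x : Fin m × Fin m → Bool,
      ¬ ((encodingGraph.encode ⟨m, SimpleGraph.fromRel fun u v =>
            (fun q : Fin m × Fin m => x (ρ q.1, ρ q.2)) (u, v) = true⟩ ∈
              ({w | (bitAtFn ∘ fanoutFn (List.tail ∘ binToUnaryFn ∘ fanoutFn sndP fstP) sndP) w = [true]} :
                Language Bool)) ↔
          (encodingGraph.encode ⟨m, SimpleGraph.fromRel fun u v => x (u, v) = true⟩ ∈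
              ({w | (bitAtFn ∘ fanoutFn (List.tail ∘ binToUnaryFn ∘ fanoutFn sndP fstP) sndP) w = [true]} :
                Language Bool))) := by
  have h1 : 1 ≤ m := by omega
  have hlog : 2 ≤ Nat.log 2 m := Nat.le_log_of_pow_le (by norm_num) (by omega)
  let a : Fin m := ⟨m - 1, by omega⟩
  let b : Fin m := ⟨m - 2, by omega⟩
  let z : Fin m := ⟨0, by omega⟩
  refine ⟨Equiv.swap a b, ?_, fun q => decide (q = (z, b)), ?_⟩
  · intro i hi
    refine Equiv.swap_apply_of_ne_of_ne ?_ ?_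
    · rintro rfl
      simp [a] at hi
      omega
    · rintro rfl
      simp [b] at hi
      omega
  · intro key
    rw [encode_mem_probeLang_iff h1, encode_mem_probeLang_iff h1] at key
    have hza : (⟨0, h1⟩ : Fin m) = z := rfl
    have hma : (⟨m - 1, Nat.sub_lt h1 Nat.one_pos⟩ : Fin m) = a := rfl
    rw [hza, hma] at key
    have hswz : Equiv.swap a b z = z :=
      Equiv.swap_apply_of_ne_of_ne (by simp [a, z, Fin.ext_iff]; omega)
        (by simp [b, z, Fin.ext_iff]; omega)
    have hswa : Equiv.swap a b a = b := Equiv.swap_apply_left a b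
    have hab : a ≠ b := by simp [a, b, Fin.ext_iff]; omega
    have haz : a ≠ z := by simp [a, z, Fin.ext_iff]; omega
    have hadj' : (SimpleGraph.fromRel fun u v =>
        (fun q : Fin m × Fin m => decide ((Equiv.swap a b q.1, Equiv.swap a b q.2) = (z, b)))
          (u, v) = true).Adj z a := by
      rw [SimpleGraph.fromRel_adj]
      refine ⟨haz.symm, Or.inl ?_⟩
      simp [hswz, hswa]
    have hadj : ¬ (SimpleGraph.fromRel fun u v => decide ((u, v) = (z, b)) = true).Adj z a := by
      rw [SimpleGraph.fromRel_adj]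
      rintro ⟨-, h | h⟩
      · simp at h
        exact hab h
      · simp at h
        exact haz h.1
    exact hadj (key.1 hadj')

/-- **The hardness clause of `WindowBarrier` holds for free once invariance is dropped**: there is an
`L ∈ P` (the probe language) whose graph slices have, for EVERY size bound and every `m ≥ 4`, no
`Bud(m,⌊log₂ m⌋)`-symmetric threshold circuit — because they are not invariant. So the crux
"minus its invariance clause" is a theorem; its content is invariance ∧ hardness for one `L`.
(Vocabulary: `HasSymCircuit tcBasis`, `pointStabiliserBudget` = the route's inline `HasSym`, `Bud`.)
[folklore] -/
theorem hardness_without_invariance :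
    ∃ L ∈ Classes.P, ∀ p : Polynomial ℕ, ∃ᶠ m in atTop,
      ¬ HasSymCircuit tcBasis (pointStabiliserBudget m (Nat.log 2 m)) (p.eval m)
        (fun x : Fin m × Fin m → Bool =>
          decide (encodingGraph.encode ⟨m, SimpleGraph.fromRel fun u v => x (u, v) = true⟩ ∈ L)) := by
  refine ⟨{w | (bitAtFn ∘ fanoutFn (List.tail ∘ binToUnaryFn ∘ fanoutFn sndP fstP) sndP) w = [true]},
    probeLang_mem_P, fun p => ?_⟩
  refine Filter.frequently_atTop.2 fun n => ⟨max n 4, le_max_left _ _, ?_⟩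
  obtain ⟨ρ, hρ, x, hx⟩ := probe_slice_not_invariant (le_max_right n 4)
  rintro ⟨C, hB, -, hΓ, hf⟩
  exact hx ((decide_eq_decide).1 (hΓ.invariant_of_computes hB hf hρ x))


/-! ### A refutation of the crux would be a generic bridge -/

/-- Membership of a graph code in `HAMCIRCUIT` is Hamiltonicity. [folklore] -/
theorem encode_mem_HAMCIRCUIT_iff (m : ℕ) (G : SimpleGraph (Fin m)) :
    encodingGraph.encode ⟨m, G⟩ ∈ HAMCIRCUIT ↔ G.IsHamiltonian :=
  encodingGraph.mem_toLanguage_iff hamCircuitSet ⟨m, G⟩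

/-- Relabelling the matrix by a vertex permutation does not change Hamiltonicity of the graph read
off it (`ρ` is a graph isomorphism). [folklore] -/
theorem isHamiltonian_relabel_iff {m : ℕ} (ρ : Equiv.Perm (Fin m)) (x : Fin m × Fin m → Bool) :
    (SimpleGraph.fromRel fun u v =>
        (fun q : Fin m × Fin m => x (ρ q.1, ρ q.2)) (u, v) = true).IsHamiltonian ↔
      (SimpleGraph.fromRel fun u v => x (u, v) = true).IsHamiltonian :=
  Literature.Combinatorics.SimpleGraph.isHamiltonian_iff_of_iso
    { toEquiv := ρ
      map_rel_iff' := by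
        intro a b
        simp [SimpleGraph.fromRel_adj, ρ.injective.ne_iff] }

/-- **If HAM were in `P`, the lower-bound crux `WindowHam` would prove `WindowBarrier`** (witness
`L = HAMCIRCUIT`, whose slices are invariant under every vertex permutation). [folklore] -/
theorem windowHam_imp_windowBarrier_of_ham_mem_P (hP : HAMCIRCUIT ∈ Classes.P) (hW : WindowHam) :
    WindowBarrier := by
  refine ⟨HAMCIRCUIT, hP, fun m ρ _ x => ?_, fun p => ?_⟩
  · rw [encode_mem_HAMCIRCUIT_iff, encode_mem_HAMCIRCUIT_iff]
    exact isHamiltonian_relabel_iff ρ x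
  · refine (hW p).mono fun m hm => ?_
    have hfun : (fun x : Fin m × Fin m → Bool =>
        decide (encodingGraph.encode ⟨m, SimpleGraph.fromRel fun u v => x (u, v) = true⟩ ∈
          HAMCIRCUIT)) =
        fun x : Fin m × Fin m → Bool =>
          decide ((SimpleGraph.fromRel fun u v => x (u, v) = true).IsHamiltonian) := by
      funext x
      exact (decide_eq_decide).2 (encode_mem_HAMCIRCUIT_iff m _)
    rw [hfun]
    exact hm

/-- **A refutation of `WindowBarrier` upgrades `WindowHam` to `HAMCIRCUIT ∉ P` outright** — i.e. it
would be a generic bridge from the route's symmetric lower bound to `P ≠ NP` (with the proved model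
bridges `P_bool_eq_holds`, `NP_bool_eq_holds`, `HAMCIRCUIT_mem_NP`). This is the precise sense in
which the crux resists cheap refutation. [folklore] -/
theorem ham_not_mem_P_of_not_windowBarrier (h : ¬ WindowBarrier) (hW : WindowHam) :
    HAMCIRCUIT ∉ Classes.P := fun hP => h (windowHam_imp_windowBarrier_of_ham_mem_P hP hW)

end Summit.PneNP.WindowBarrier.Negative
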